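import Mathlib
import Summits.Ventures.HodgeRepro2.T5HeckeCharacterRepresentation
import Summits.Ventures.HodgeRepro2.T5InertHeckeCharacter
import Summits.Ventures.HodgeRepro2.T5InertIwasawa
import Summits.Ventures.HodgeRepro2.T5InertSatakeTransform

/-!
# THE UNRAMIFIED SPECTRUM OF `U(J₃(u))` AT AN INERT PLACE IS `k`: EVERY `T₁`-EIGENVALUE OCCURS, ONCE

Tier-5 support N3 / §G-N4.2 (seat p3, gen 84). On the inert local package `(R, E, star, u, ϖ)` of the record,
`H(U(J₃(u)), K) = k[T₁]` (file `T5InertTopCoefficient`), its characters are the values at `T₁`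
(`T5InertHeckeCharacter.bijective_apply_one`), and two irreducible `K`-finite representations with non-zero
finite-dimensional `K`-invariants are isomorphic iff their `T₁`-eigenvalues agree
(`nonempty_equiv_iff_heckeCharacter_apply_one_eq`). File `T5HeckeCharacterRepresentation` makes every character
the Hecke character of such a representation. This file assembles THE CLASSIFICATION OF THE UNRAMIFIED
(`K`-spherical) IRREDUCIBLE REPRESENTATIONS BY THEIR `T₁`-EIGENVALUE, and reads it in Satake's parameter:

* **`exists_algHom_apply_one_eq`** — for every `λ : k` there is a character `χ_λ` of `H` with `χ_λ(T₁) = λ`;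
* **`exists_irreducible_heckeCharacter_apply_one_eq`** — for every `λ : k` there is an irreducible `K`-finite
  representation `π` with non-zero finite-dimensional `π^K` and `T₁`-eigenvalue `λ` (the representation
  `π_{χ_λ}` of `T5HeckeCharacterRepresentation`) — THE SPHERICAL SPECTRUM IS ONTO `k`;
* **`nonempty_equiv_quotRep_char_iff`** — and every irreducible `K`-finite `ρ` with non-zero finite-dimensional
  `ρ^K` is isomorphic to `π_{χ_λ}` iff its `T₁`-eigenvalue is `λ` — ONCE;
* **`exists_param_eq`** — over an algebraically closed `k` with `q ≠ 0`, every `λ` is `q²(α + α⁻¹) + (q − 1)`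
  for some `α ≠ 0` (a quadratic); **`exists_param_heckeSMul_cellU_one_eq`** — hence for every `λ` there is
  `α ≠ 0` such that the spherical vector of the unramified principal series `I(α q⁻²)` has `T₁`-eigenvalue
  `λ` (file `T5InertIwasawa`'s Macdonald–Satake identification).

So the irreducible `K`-spherical representations of `U(J₃(u))` are classified by `λ ∈ k`, equivalently by the
Satake parameter `α` modulo `α ↔ α⁻¹`, and each `λ` is realised on the spherical vector of `I(χ_α)` — the
«principal-series identification» of the lane's still-print list, in the tree's vocabulary (what is NOT proved
here: that `π_{χ_λ}` itself embeds in `I(χ_α)`; the record only needs the eigenvalue and the uniqueness).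

Nothing here is a statement about (P), theta lifts or L-values. §8(d): uses an L-value-free non-vanishing
device: NO.
-/

open Summit.Ventures.HodgeRepro2.T5HeckeBasisCells Summit.Ventures.HodgeRepro2.T5HeckePermutationModule
  Summit.Ventures.HodgeRepro2.T5HeckeInducedIrreducible Summit.Ventures.HodgeRepro2.T5HeckeCommutativeMultiplicityOne
  Summit.Ventures.HodgeRepro2.T5LevelIdempotent Summit.Ventures.HodgeRepro2.LevelPositivity
  Summit.Ventures.HodgeRepro2.T5HeckeCharacterRepresentation Summit.Ventures.HodgeRepro2.T5InertHeckeCharacter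
  Summit.Ventures.HodgeRepro2.T5UnitaryGroupForm Summit.Ventures.HodgeRepro2.T5HermitianThreeElements
  Summit.Ventures.HodgeRepro2.T5UnitaryHeckeAdjoint Summit.Ventures.HodgeRepro2.T5InertUnipotentResidue
  Summit.Ventures.HodgeRepro2.T5InertSatakeTransform Summit.Ventures.HodgeRepro2.T5InertPrincipalSeries
  Summit.Ventures.HodgeRepro2.T5InertIwasawa Summit.Ventures.HodgeRepro2.T5HeckeDoubleCoset

namespace Summit.Ventures.HodgeRepro2.T5InertSphericalClassification

section Quadratic

variable {k : Type*} [Field k] [IsAlgClosed k]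

/-- **Every `λ` is `q²(α + α⁻¹) + (q − 1)` for some `α ≠ 0`** over an algebraically closed field, `q ≠ 0`
(a root of `q² X² − (λ − q + 1) X + q²`, non-zero since the constant term is `q²`). -/
theorem exists_param_eq (q : k) (hq : q ≠ 0) (lam : k) :
    ∃ α : k, α ≠ 0 ∧ lam = q ^ 2 * (α + α⁻¹) + (q - 1) := by
  open Polynomial in
  obtain ⟨α, hα⟩ := IsAlgClosed.exists_root (C (q ^ 2) * X ^ 2 + C (-(lam - q + 1)) * X + C (q ^ 2))
    (by rw [degree_quadratic (pow_ne_zero 2 hq)]; decide)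
  have hev : q ^ 2 * α ^ 2 + -(lam - q + 1) * α + q ^ 2 = 0 := by
    simpa [eval_add, eval_mul, eval_pow, eval_C, eval_X] using hα
  have hα0 : α ≠ 0 := by
    rintro rfl
    simp at hev
    exact hq hev
  refine ⟨α, hα0, ?_⟩
  apply mul_left_cancel₀ hα0
  have hαα : α * α⁻¹ = 1 := mul_inv_cancel₀ hα0
  linear_combination (-1 : k) * hev + (-(q ^ 2)) * hαα

end Quadratic

section Inert

universe uR uE uk

variable {R : Type uR} {E : Type uE} [CommRing R] [Field E] [StarRing E] [Algebra R E] [IsFractionRing R E]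
  [IsDomain R] [IsDiscreteValuationRing R] [Finite (IsLocalRing.ResidueField R)]
  (hstar : ∀ x : E, IsLocalization.IsInteger R x → IsLocalization.IsInteger R (star x))
  (u : E) (hsu : star u = u) (hu0 : u ≠ 0) (hu : IsLocalization.IsInteger R u)
  (hu' : IsLocalization.IsInteger R u⁻¹) {ϖ : R} (hϖ : Irreducible ϖ)
  (hs : star (algebraMap R E ϖ) = algebraMap R E ϖ) (k : Type uk) [Field k] [CharZero k]

omit [IsFractionRing R E] in
/-- `q = #{t : t + t̄ = 0}` is non-zero in `k` (characteristic `0`, `card_traceZero_pos`). -/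
theorem natCast_card_traceZero_ne_zero : ((Nat.card (traceZero R E) : ℕ) : k) ≠ 0 :=
  Nat.cast_ne_zero.mpr (card_traceZero_pos (R := R) (E := E)).ne'

omit [CharZero k] in
include hstar hsu hu0 hu hu' hϖ hs in
/-- **Every `λ : k` is the value at `T₁` of a character of `H(U(J₃(u)), K)`** (the surjectivity in
`T5InertHeckeCharacter.bijective_apply_one`). -/
theorem exists_algHom_apply_one_eq (lam : k) :
    ∃ χ : heckeAlgebra k (hyperspecialSubgroup R (J3 u)) →ₐ[k] k,
      χ (heckeBasisCells hstar u hsu hu0 hu hu' hϖ hs k 1) = lam :=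
  (bijective_apply_one hstar u hsu hu0 hu hu' hϖ hs k (C := k)).surjective lam

variable [IsAlgClosed k]

include hstar hsu hu0 hu hu' hϖ hs in
/-- **THE SPHERICAL SPECTRUM IS ONTO `k`**: for every `λ : k` there is an irreducible `K`-finite representation
`π` of `U(J₃(u))` with non-zero finite-dimensional `K`-invariants and `T₁`-eigenvalue `λ` (`π = π_{χ_λ}` of
`T5HeckeCharacterRepresentation`, `χ_λ(T₁) = λ`). -/
theorem exists_irreducible_heckeCharacter_apply_one_eq (lam : k) :
    ∃ (V : Type (max uE uk)) (_ : AddCommGroup V) (_ : Module k V)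
      (π : Representation k (formUnitaryGroup (J3 u)) V) (_ : π.IsIrreducible)
      (hK : KFinite π (hyperspecialSubgroup R (J3 u)))
      (_ : FiniteDimensional k (invariants π (hyperspecialSubgroup R (J3 u))))
      (hne : invariants π (hyperspecialSubgroup R (J3 u)) ≠ ⊥),
      heckeCharacter π hK (fun _ => inferInstance) hne (mul_comm' hstar u hsu hu0 hu hu' hϖ hs k)
        (heckeBasisCells hstar u hsu hu0 hu hu' hϖ hs k 1) = lam := by
  obtain ⟨χ, hχ⟩ := exists_algHom_apply_one_eq hstar u hsu hu0 hu hu' hϖ hs k lam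
  letI := charModule k (hyperspecialSubgroup R (J3 u)) χ
  letI := charScalarTower k (hyperspecialSubgroup R (J3 u)) χ
  haveI := isIrreducible_quotRep_char k (hyperspecialSubgroup R (J3 u)) (fun _ => inferInstance) χ
  haveI := finiteDimensional_invariants_quotRep_char k (hyperspecialSubgroup R (J3 u)) (fun _ => inferInstance) χ
  refine ⟨_, _, _, quotRep k (hyperspecialSubgroup R (J3 u)) k (fun _ => inferInstance), inferInstance,
    kFinite_quotRep_char k (hyperspecialSubgroup R (J3 u)) (fun _ => inferInstance) χ, inferInstance,
    invariants_quotRep_char_ne_bot k (hyperspecialSubgroup R (J3 u)) (fun _ => inferInstance) χ, ?_⟩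
  rw [heckeCharacter_quotRep_char k (hyperspecialSubgroup R (J3 u)) (fun _ => inferInstance) χ
    (mul_comm' hstar u hsu hu0 hu hu' hϖ hs k), hχ]

include hstar hsu hu0 hu hu' hϖ hs in
/-- **ONCE**: an irreducible `K`-finite `ρ` with non-zero finite-dimensional `K`-invariants is isomorphic to
`π_{χ}` (`χ(T₁) = λ`) iff its `T₁`-eigenvalue is `λ` (`nonempty_equiv_iff_heckeCharacter_apply_one_eq` and
`heckeCharacter_quotRep_char`). -/
theorem nonempty_equiv_quotRep_char_iff (lam : k)
    (χ : heckeAlgebra k (hyperspecialSubgroup R (J3 u)) →ₐ[k] k)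
    (hχ : χ (heckeBasisCells hstar u hsu hu0 hu hu' hϖ hs k 1) = lam)
    {V : Type*} [AddCommGroup V] [Module k V] (ρ : Representation k (formUnitaryGroup (J3 u)) V)
    [ρ.IsIrreducible] (hK : KFinite ρ (hyperspecialSubgroup R (J3 u)))
    [FiniteDimensional k (invariants ρ (hyperspecialSubgroup R (J3 u)))]
    (hne : invariants ρ (hyperspecialSubgroup R (J3 u)) ≠ ⊥) :
    letI := charModule k (hyperspecialSubgroup R (J3 u)) χ
    letI := charScalarTower k (hyperspecialSubgroup R (J3 u)) χ
    haveI := isIrreducible_quotRep_char k (hyperspecialSubgroup R (J3 u)) (fun _ => inferInstance) χ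
    haveI := finiteDimensional_invariants_quotRep_char k (hyperspecialSubgroup R (J3 u))
      (fun _ => inferInstance) χ
    Nonempty (ρ.Equiv (quotRep k (hyperspecialSubgroup R (J3 u)) k (fun _ => inferInstance))) ↔
      heckeCharacter ρ hK (fun _ => inferInstance) hne (mul_comm' hstar u hsu hu0 hu hu' hϖ hs k)
        (heckeBasisCells hstar u hsu hu0 hu hu' hϖ hs k 1) = lam := by
  letI := charModule k (hyperspecialSubgroup R (J3 u)) χ
  letI := charScalarTower k (hyperspecialSubgroup R (J3 u)) χ
  haveI := isIrreducible_quotRep_char k (hyperspecialSubgroup R (J3 u)) (fun _ => inferInstance) χ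
  haveI := finiteDimensional_invariants_quotRep_char k (hyperspecialSubgroup R (J3 u))
    (fun _ => inferInstance) χ
  rw [nonempty_equiv_iff_heckeCharacter_apply_one_eq hstar u hsu hu0 hu hu' hϖ hs k ρ
    (quotRep k (hyperspecialSubgroup R (J3 u)) k (fun _ => inferInstance)) hK
    (kFinite_quotRep_char k (hyperspecialSubgroup R (J3 u)) (fun _ => inferInstance) χ) hne
    (invariants_quotRep_char_ne_bot k (hyperspecialSubgroup R (J3 u)) (fun _ => inferInstance) χ),
    heckeCharacter_quotRep_char k (hyperspecialSubgroup R (J3 u)) (fun _ => inferInstance) χ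
      (mul_comm' hstar u hsu hu0 hu hu' hϖ hs k), hχ]

include hstar hsu hu0 hu hu' hϖ hs in
/-- **EVERY `T₁`-EIGENVALUE IS REALISED ON A SPHERICAL VECTOR OF AN UNRAMIFIED PRINCIPAL SERIES**: for every
`λ : k` there is `α ≠ 0` with `λ = q²(α + α⁻¹) + (q − 1)` such that every spherical vector `f₀` of `I(α q⁻²)`
(`f₀ ∈ I(α q⁻²)^K`, `f₀(1) = 1`) satisfies `T₁ f₀ = λ f₀` (file `T5InertIwasawa`'s
`heckeSMul_cellU_one_eq_smul_param'`). -/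
theorem exists_param_heckeSMul_cellU_one_eq
    [Finite (MulAction.orbit (hyperspecialSubgroup R (J3 u))
      ((cellU hϖ hs u 1 : formUnitaryGroup (J3 u)) :
        formUnitaryGroup (J3 u) ⧸ hyperspecialSubgroup R (J3 u)))]
    (he : ∃ e : R, algebraMap R E e + star (algebraMap R E e) = 1)
    (hnt : ∃ t, T5InertResidueInvolution.residueStar hstar hϖ hs t ≠ t) (lam : k) :
    ∃ α : k, α ≠ 0 ∧
      lam = (Nat.card (traceZero R E) : k) ^ 2 * (α + α⁻¹) + ((Nat.card (traceZero R E) : k) - 1) ∧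
      ∀ {f₀ : formUnitaryGroup (J3 u) → k},
        IsInduced u hϖ hs k (α * ((Nat.card (traceZero R E) : k) ^ 2)⁻¹) f₀ →
        ∀ (hf₀K : f₀ ∈ invariants (rightRegular k) (hyperspecialSubgroup R (J3 u))), f₀ 1 = 1 →
          heckeSMul (rightRegular k)
              (doubleCosetOp k (hyperspecialSubgroup R (J3 u)) (cellU hϖ hs u 1)) ⟨f₀, hf₀K⟩ =
            lam • ⟨f₀, hf₀K⟩ := by
  obtain ⟨α, hα0, hlam⟩ := exists_param_eq ((Nat.card (traceZero R E) : ℕ) : k)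
    (natCast_card_traceZero_ne_zero (R := R) (E := E) k) lam
  refine ⟨α, hα0, hlam, fun {f₀} hf hf₀K h1 => ?_⟩
  rw [heckeSMul_cellU_one_eq_smul_param' hstar u hsu hu0 hu hu' hϖ hs k he hnt hα0 hf hf₀K h1, hlam]

end Inert

end Summit.Ventures.HodgeRepro2.T5InertSphericalClassification
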